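import Summits.CriticalPhenomena.CardyFormulaZ2.Theorems.CardySelfDualSegmentSegmentClosedStubGateTB
import Literature.Probability.Percolation.CornerPercolation
import Literature.Probability.Percolation.LatticeWalksGM
import HarnessLib

/-!
# Stub `stub_gateLR` of line `Sketch` (crux `SegmentClosed`, stmt-CriticalPhenomena-5473,
# route `CardySelfDualSegment`)

The deterministic **forced vertical gate** of the confinement step of line `Sketch`.

Setting: bond configurations `ω ⊆ E(ℤ²)` on the square lattice drawn by
`squareLatticeEmbedding.z v = √2 · (v 0 + i · v 1)` and rescaled by the mesh `δ > 0`; the crude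
crossing event `embDomainCrossing z Ω δ A B` (an open path all of whose rescaled vertices lie in
`Ω`, starting within `2δ` of `A` and ending within `2δ` of `B`) and the left–right box crossing
`embRectCrossing z' a b` (an open path inside `[-2, a + 2] × [0, b]` from `{re ≤ 0}` to `{a ≤ re}`)
of the prelude.

Statement (`stub_gateLR`): if every point of `Ω` within `2δ` of `A` has `re ≤ x₁`, every point of
`Ω` within `2δ` of `B` has `re ≥ x₂`, and the part of `Ω` in the slab `x₁ ≤ re ≤ x₂` has
`im ∈ [y₁, y₂]`, then for `0 ≤ a ≤ (x₂ - x₁)/δ - 4` and `b ≥ (y₂ - y₁)/δ` there is ONE translation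
`w` such that every lattice configuration in the crude crossing event lies in the left–right
crossing event of the translated box `w + [0, a] × [0, b]` (in lattice units).

Proof: with `k₁ = ⌈x₁ / (√2 δ)⌉`, `k = ⌈a / √2⌉` and `w = √2 k₁ + i y₁/δ`, the crude open path
starts at a column `≤ k₁` (its start is within `2δ` of `A`, hence left of `x₁`) and ends at a
column `≥ k₁ + k` (its end is right of `x₂`, and `√2 δ (k₁ + k) < x₁ + a δ + 2√2 δ < x₂`); clipping
it at the columns `k₁` and `k₁ + k` (`exists_openConnIn_clip`, the first coordinate is
`1`-Lipschitz along the edges of `ℤ²`) leaves an open path whose vertices have columns in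
`[k₁, k₁ + k]`, hence rescaled real parts in `[x₁, x₂]`, hence (hypothesis on `Ω`) rescaled
imaginary parts in `[y₁, y₂]`; in the coordinates `z - w` this is a path inside
`[0, √2 k] × [0, (y₂ - y₁)/δ] ⊆ [-2, a + 2] × [0, b]` from `re = 0` to `re = √2 k ≥ a`.
Elementary; no literature fact is used. The coordinate bookkeeping lemmas (`gateTB_smul_re`,
`gateTB_sub_re`, …) are shared with the transposed stub `stub_gateTB`.
-/

noncomputable section

open Set Filter Metric MeasureTheory Complex
open scoped Topology
open Literature.Probability.RandomPlanarGeometry Literature.Probability.Percolation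
open Literature.Probability.LatticeModels

namespace Summit.CriticalPhenomena.CardyFormulaZ2.Cruxes.SegmentClosed.Sketch

/-- **Forced vertical gate.** If every point of `Ω` within `2δ` of `A` has `re ≤ x₁`, every
point of `Ω` within `2δ` of `B` has `re ≥ x₂`, and the part of `Ω` in the vertical slab
`x₁ ≤ re ≤ x₂` has `im ∈ [y₁, y₂]`, then a crude crossing of `Ω` from `A` to `B` at mesh `δ`
by nearest-neighbour edges of `ℤ²` (drawn by `squareLatticeEmbedding.z = √2·`) contains a
left–right crossing of a translate of the lattice box `[0, a] × [0, b]` whenever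
`a ≤ (x₂ - x₁)/δ - 4` and `b ≥ (y₂ - y₁)/δ` (clip the open walk at two lattice columns,
`exists_openConnIn_clip`). The translation is `w = √2 ⌈x₁/(√2 δ)⌉ + i y₁/δ`. -/
theorem stub_gateLR (Ω A B : Set ℂ) {δ x₁ x₂ y₁ y₂ a b : ℝ} (hδ : 0 < δ)
    (hA : ∀ p ∈ Ω, infDist p A ≤ 2 * δ → p.re ≤ x₁)
    (hB : ∀ p ∈ Ω, infDist p B ≤ 2 * δ → x₂ ≤ p.re)
    (hΩ : ∀ p ∈ Ω, x₁ ≤ p.re → p.re ≤ x₂ → y₁ ≤ p.im ∧ p.im ≤ y₂)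
    (ha : 0 ≤ a) (hax : a ≤ (x₂ - x₁) / δ - 4) (hb : (y₂ - y₁) / δ ≤ b) :
    ∃ w : ℂ, ∀ ω : BondConfig (Site 2), ω ⊆ (zdGraph 2).edgeSet →
      ω ∈ embDomainCrossing squareLatticeEmbedding.z Ω δ A B →
      ω ∈ embRectCrossing (fun v => squareLatticeEmbedding.z v - w) a b := by
  -- the constants `√2`, `k₁ = ⌈x₁ / (√2 δ)⌉`, `k = ⌈a / √2⌉`
  have hs0 : 0 < Real.sqrt 2 := Real.sqrt_pos.2 (by norm_num)
  have hs2 : Real.sqrt 2 * Real.sqrt 2 = 2 := Real.mul_self_sqrt (by norm_num)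
  have hs_lt : Real.sqrt 2 < 2 := by nlinarith
  have ht : 0 < Real.sqrt 2 * δ := mul_pos hs0 hδ
  obtain ⟨k₁, hk₁le, hk₁lt⟩ : ∃ k₁ : ℤ, x₁ ≤ Real.sqrt 2 * δ * k₁ ∧
      Real.sqrt 2 * δ * k₁ < x₁ + Real.sqrt 2 * δ := by
    refine ⟨⌈x₁ / (Real.sqrt 2 * δ)⌉, ?_, ?_⟩
    · have h := Int.le_ceil (x₁ / (Real.sqrt 2 * δ))
      rw [div_le_iff₀ ht] at h
      linarith
    · have h := Int.ceil_lt_add_one (x₁ / (Real.sqrt 2 * δ))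
      have h' : (⌈x₁ / (Real.sqrt 2 * δ)⌉ : ℝ) - 1 < x₁ / (Real.sqrt 2 * δ) := by linarith
      rw [lt_div_iff₀ ht] at h'
      linarith
  obtain ⟨k, hk0, hkle, hklt⟩ :
      ∃ k : ℤ, 0 ≤ k ∧ a ≤ Real.sqrt 2 * k ∧ Real.sqrt 2 * k < a + Real.sqrt 2 := by
    refine ⟨⌈a / Real.sqrt 2⌉, Int.ceil_nonneg (div_nonneg ha hs0.le), ?_, ?_⟩
    · have h := Int.le_ceil (a / Real.sqrt 2)
      rw [div_le_iff₀ hs0] at h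
      linarith
    · have h := Int.ceil_lt_add_one (a / Real.sqrt 2)
      have h' : (⌈a / Real.sqrt 2⌉ : ℝ) - 1 < a / Real.sqrt 2 := by linarith
      rw [lt_div_iff₀ hs0] at h'
      linarith
  have haδ : (a + 4) * δ ≤ x₂ - x₁ := (le_div_iff₀ hδ).1 (by linarith)
  have hbδ : y₂ - y₁ ≤ b * δ := (div_le_iff₀ hδ).1 hb
  have hkδ : δ * (Real.sqrt 2 * k) < δ * (a + Real.sqrt 2) := mul_lt_mul_of_pos_left hklt hδ
  have hsδ2 : Real.sqrt 2 * δ ≤ 2 * δ := mul_le_mul_of_nonneg_right hs_lt.le hδ.le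
  -- the window of columns `[k₁, k₁ + k]` is drawn strictly inside the slab `[x₁, x₂)`
  have hwin : Real.sqrt 2 * δ * ((k₁ + k : ℤ) : ℝ) < x₂ := by
    push_cast
    linarith
  refine ⟨((Real.sqrt 2 * (k₁ : ℝ) : ℝ) : ℂ) + ((y₁ / δ : ℝ) : ℂ) * I, fun ω hω h => ?_⟩
  rw [mem_embDomainCrossing_iff] at h
  obtain ⟨u, hu, v, hv, hconn⟩ := h
  obtain ⟨huΩ, hvΩ, -⟩ := id hconn
  -- the start is left of column `k₁`, the end right of column `k₁ + k`
  have hu1 := hA ((δ : ℂ) * squareLatticeEmbedding.z u) huΩ hu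
  have hv1 := hB ((δ : ℂ) * squareLatticeEmbedding.z v) hvΩ hv
  rw [gateTB_smul_re] at hu1 hv1
  have hu0 : u 0 ≤ k₁ := by
    have : Real.sqrt 2 * δ * (u 0 : ℝ) ≤ Real.sqrt 2 * δ * (k₁ : ℝ) := by linarith
    exact_mod_cast le_of_mul_le_mul_left this ht
  have hv0 : k₁ + k ≤ v 0 := by
    have : Real.sqrt 2 * δ * ((k₁ + k : ℤ) : ℝ) < Real.sqrt 2 * δ * (v 0 : ℝ) := by linarith
    exact_mod_cast (lt_of_mul_lt_mul_left this ht.le).le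
  -- clip the crude open path at the columns `k₁` and `k₁ + k`
  -- (the first coordinate is `1`-Lipschitz along the edges of `ℤ²`, `gateTB_coord_le_of_adj`)
  obtain ⟨x', y', hx', hy', hconn'⟩ := exists_openConnIn_clip hω (fun v : Site 2 => v 0)
    (fun u' v' huv => gateTB_coord_le_of_adj 0 u' v' huv) (le_add_of_nonneg_right hk0) hu0 hv0
    hconn
  have hx'0 : (x' 0 : ℝ) = k₁ := by exact_mod_cast hx'
  have hy'0 : (y' 0 : ℝ) = k₁ + k := by exact_mod_cast hy'
  refine ⟨x', ?_, y', ?_, openConnIn_mono (fun y hy => ?_) _ _ hconn'⟩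
  · -- the new start lies on the left side `re = 0` of the translated box
    show (squareLatticeEmbedding.z x' - _).re ≤ 0
    rw [gateTB_sub_re, hx'0, sub_self]
  · -- the new end lies on or beyond the right side `re = a`
    show a ≤ (squareLatticeEmbedding.z y' - _).re
    rw [gateTB_sub_re, hy'0]
    linarith
  · -- clipped vertices lie in the box `[-2, a + 2] × [0, b]`
    obtain ⟨hyΩ, hy1, hy2⟩ := hy
    have hy1' : (k₁ : ℝ) ≤ y 0 := by exact_mod_cast hy1
    have hy2' : (y 0 : ℝ) ≤ k₁ + k := by exact_mod_cast hy2
    have hlo : Real.sqrt 2 * δ * (k₁ : ℝ) ≤ Real.sqrt 2 * δ * (y 0 : ℝ) :=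
      mul_le_mul_of_nonneg_left hy1' ht.le
    have hhi : Real.sqrt 2 * δ * (y 0 : ℝ) ≤ Real.sqrt 2 * δ * ((k₁ : ℝ) + k) :=
      mul_le_mul_of_nonneg_left hy2' ht.le
    push_cast at hwin
    have him := hΩ ((δ : ℂ) * squareLatticeEmbedding.z y) hyΩ
      (by rw [gateTB_smul_re]; linarith) (by rw [gateTB_smul_re]; linarith)
    rw [gateTB_smul_im] at him
    show (squareLatticeEmbedding.z y - _).re ∈ Icc (-2) (a + 2) ∧
      (squareLatticeEmbedding.z y - _).im ∈ Icc 0 b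
    rw [gateTB_sub_re, gateTB_sub_im]
    have hre0 : Real.sqrt 2 * (k₁ : ℝ) ≤ Real.sqrt 2 * (y 0 : ℝ) :=
      mul_le_mul_of_nonneg_left hy1' hs0.le
    have hre1 : Real.sqrt 2 * (y 0 : ℝ) ≤ Real.sqrt 2 * ((k₁ : ℝ) + k) :=
      mul_le_mul_of_nonneg_left hy2' hs0.le
    refine ⟨⟨by linarith, by linarith⟩, ?_, ?_⟩
    · rw [sub_nonneg, div_le_iff₀ hδ]
      linarith [him.1]
    · rw [sub_le_comm, le_div_iff₀ hδ]
      linarith [him.2]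

end Summit.CriticalPhenomena.CardyFormulaZ2.Cruxes.SegmentClosed.Sketch

end
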